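import Mathlib

/-!
# PercRepro — piece (D) of the CodeBound8 hand proof: orthogonal spans inside `1^⊥` (typer-2, gen 5)

p4 (`proofs/P4-seven.md` §9, 10:09:05Z / 10:17:50Z kernel plan; p4 takes (G) and (K), typer-2 takes (D)):
the three colour classes of an 8-point code give three MUTUALLY ORTHOGONAL subspaces `U_X` of the hyperplane
`1^⊥ ⊂ ℝ⁸` (spanned by the balanced sign vectors `x_σ ∈ {±1}^8` of the members of each colour); their
dimensions therefore add up to at most `7`. This file is pure Mathlib: no cell definitions.

* **`finrank_add_three_le_of_isOrtho`** — three pairwise orthogonal subspaces `U₁ ⟂ U₂`, `U₁ ⟂ U₃`, `U₂ ⟂ U₃`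
  of a finite-dimensional real inner product space, all inside a subspace `W`, satisfy
  `finrank U₁ + finrank U₂ + finrank U₃ ≤ finrank W` (the sum is the dimension of their direct sum);
* `finrank_orthogonal_ones_eight` — the hyperplane `(ℝ ∙ 𝟙)ᗮ` of `EuclideanSpace ℝ (Fin 8)` has dimension `7`;
* **`finrank_add_three_le_seven`** — so three mutually orthogonal subspaces of `𝟙^⊥ ⊂ ℝ⁸` have dimension sum `≤ 7`
  (the (D) inequality: with `dim U_X ≥ h(m_X)` from piece (H) and the profile arithmetic this bounds the code).
-/

namespace PercRepro

open Module Submodule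

/-- **Three pairwise orthogonal subspaces inside `W` have dimension sum `≤ finrank W`.** -/
theorem finrank_add_three_le_of_isOrtho {E : Type*} [NormedAddCommGroup E] [InnerProductSpace ℝ E]
    [FiniteDimensional ℝ E] (U₁ U₂ U₃ W : Submodule ℝ E) (h12 : U₁ ⟂ U₂) (h13 : U₁ ⟂ U₃)
    (h23 : U₂ ⟂ U₃) (hW1 : U₁ ≤ W) (hW2 : U₂ ≤ W) (hW3 : U₃ ≤ W) :
    finrank ℝ U₁ + finrank ℝ U₂ + finrank ℝ U₃ ≤ finrank ℝ W := by
  have h1 : finrank ℝ ↥(U₁ ⊔ U₂) = finrank ℝ U₁ + finrank ℝ U₂ := by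
    have := Submodule.finrank_sup_add_finrank_inf_eq U₁ U₂
    rw [disjoint_iff.mp h12.disjoint, finrank_bot, add_zero] at this
    exact this
  have h2 : finrank ℝ ↥(U₁ ⊔ U₂ ⊔ U₃) = finrank ℝ ↥(U₁ ⊔ U₂) + finrank ℝ U₃ := by
    have horth : U₁ ⊔ U₂ ⟂ U₃ := Submodule.isOrtho_sup_left.mpr ⟨h13, h23⟩
    have := Submodule.finrank_sup_add_finrank_inf_eq (U₁ ⊔ U₂) U₃
    rw [disjoint_iff.mp horth.disjoint, finrank_bot, add_zero] at this
    exact this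
  calc finrank ℝ U₁ + finrank ℝ U₂ + finrank ℝ U₃ = finrank ℝ ↥(U₁ ⊔ U₂ ⊔ U₃) := by rw [h2, h1]
    _ ≤ finrank ℝ W := Submodule.finrank_mono (sup_le (sup_le hW1 hW2) hW3)

/-- The all-ones vector of `ℝ⁸`. -/
noncomputable def ones8 : EuclideanSpace ℝ (Fin 8) := (WithLp.equiv 2 (Fin 8 → ℝ)).symm fun _ => 1

/-- The all-ones vector is nonzero. -/
theorem ones8_ne_zero : ones8 ≠ 0 := by
  intro h
  have := congrArg (fun v : EuclideanSpace ℝ (Fin 8) => v 0) h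
  simp [ones8] at this

/-- **The hyperplane `𝟙^⊥` of `ℝ⁸` has dimension `7`.** -/
theorem finrank_orthogonal_ones_eight : finrank ℝ ((ℝ ∙ ones8)ᗮ) = 7 := by
  haveI : Fact (finrank ℝ (EuclideanSpace ℝ (Fin 8)) = 7 + 1) := ⟨by simp⟩
  exact finrank_orthogonal_span_singleton ones8_ne_zero

/-- **Piece (D)**: three mutually orthogonal subspaces of `𝟙^⊥ ⊂ ℝ⁸` have dimension sum `≤ 7`. -/
theorem finrank_add_three_le_seven (U₁ U₂ U₃ : Submodule ℝ (EuclideanSpace ℝ (Fin 8)))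
    (h12 : U₁ ⟂ U₂) (h13 : U₁ ⟂ U₃) (h23 : U₂ ⟂ U₃)
    (hW1 : U₁ ≤ (ℝ ∙ ones8)ᗮ) (hW2 : U₂ ≤ (ℝ ∙ ones8)ᗮ) (hW3 : U₃ ≤ (ℝ ∙ ones8)ᗮ) :
    finrank ℝ U₁ + finrank ℝ U₂ + finrank ℝ U₃ ≤ 7 :=
  finrank_orthogonal_ones_eight ▸
    finrank_add_three_le_of_isOrtho U₁ U₂ U₃ _ h12 h13 h23 hW1 hW2 hW3

end PercRepro
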